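import Summits.CriticalPhenomena.CardyFormulaZ2.Theorems.CardyComplexConeParafermionToSLESixFamiliesDiamondDefs
import HarnessLib

/-!
# Line `potential-darboux-picard-diamond`, stub S4 (`stub_identifyPotential`): supporting lines of a left-turning closed polygon

Helper file of the stub `stub_identifyPotential` of crux `ParafermionToSLESixFamilies` (stmt-CriticalPhenomena-11389).
In step (ii)–(iii) of the identification the boundary trace of the potential limit is a closed polygonal chain
`Q_{m+1} = Q_m + λ_m d_m` (`λ_m ≥ 0`, S1 DIR in the limit) whose directions turn LEFT, `d_{m+1} = d_m e^{iε_m}` with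
`ε_m ∈ [0, π]` and total turning `Σ_{m<N} ε_m = 2π` over a period (S1 TURN: `⅔·(π/2)` per corner of the diamond, `π/3` per
mark). This file proves the elementary convexity statement consumed there: EVERY EDGE LINE SUPPORTS THE WHOLE CHAIN, i.e.
`im ((Q_i − Q_j) · conj d_j) ≥ 0` for all `i, j` (`supportingLine_of_leftTurning`, registered helper of the crux item). Hence
the convex hull `K` of the chain lies weakly to the left of every edge line, the chain lies on `frontier K`, and an interior
point of `K` lies strictly to the left of every edge line — the hypotheses of `monotoneArg_of_pieces` and of
`DarbouxPicardConvex`. Proof: going forward from `Q_j` the edge directions make angles `A_m − A_j ∈ [0, π]` with `d_j`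
as long as the accumulated turning is `≤ π`, and going backward (i.e. forward over the complementary arc of the period)
they make angles in `[π, 2π]`; one of the two representations of `Q_i − Q_j` has all its terms of the right sign.
-/

noncomputable section

namespace Summit.CriticalPhenomena.CardyFormulaZ2.Cruxes.ParafermionToSLESixFamilies.PotentialDarbouxPicardDiamond

open scoped Real ComplexConjugate BigOperators
open Finset Complex

/-- Sums of an `N`-periodic sequence over any window of length `N` agree. -/
theorem sum_range_add_of_periodic {f : ℕ → ℝ} {N : ℕ} (hf : ∀ m, f (m + N) = f m) (j : ℕ) :
    ∑ l ∈ range N, f (j + l) = ∑ l ∈ range N, f l := by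
  induction j with
  | zero => simp
  | succ j ih =>
    have h1 : ∑ l ∈ range N, f (j + 1 + l) = ∑ l ∈ range N, f (j + (l + 1)) :=
      sum_congr rfl fun l _ => by ring_nf
    rw [h1, ← ih]
    rcases Nat.eq_zero_or_pos N with rfl | hN
    · simp
    · obtain ⟨M, rfl⟩ : ∃ M, N = M + 1 := ⟨N - 1, (Nat.sub_add_cancel hN).symm⟩
      rw [sum_range_succ' (fun l => f (j + l)), sum_range_succ (fun l => f (j + (l + 1)))]
      have : f (j + (M + 1)) = f (j + 0) := by rw [add_zero, ← hf j]
      rw [this]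

/-- **Every edge line of a left-turning closed polygon with total turning `2π` supports the polygon.** Let
`Q_{m+1} = Q_m + λ_m d_m` (`λ_m ≥ 0`), `d_{m+1} = d_m e^{iε_m}` with `ε_m ∈ [0, π]`, `ε` periodic of period `N ≥ 1` with
`Σ_{m<N} ε_m = 2π`, `Q` periodic of period `N`, `d₀ ≠ 0`. Then `im ((Q_i − Q_j) conj d_j) ≥ 0` for all `i, j`: all vertices
lie weakly to the left of every directed edge line. -/
theorem supportingLine_of_leftTurning : ∀ (Q d : ℕ → ℂ) (lam ε : ℕ → ℝ) (N : ℕ), 0 < N → d 0 ≠ 0 → (∀ m, Q (m + 1) = Q m + lam m * d m) → (∀ m, 0 ≤ lam m) → (∀ m, d (m + 1) = d m * exp (ε m * I)) → (∀ m, 0 ≤ ε m ∧ ε m ≤ Real.pi) → (∀ m, ε (m + N) = ε m) → ∑ m ∈ Finset.range N, ε m = 2 * Real.pi → (∀ m, Q (m + N) = Q m) → ∀ i j : ℕ, 0 ≤ ((Q i - Q j) * (starRingEnd ℂ) (d j)).im := by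
  intro Q d lam ε N hN hd0 hQ hlam hd hε hper hsum hQper
  -- accumulated turning `A m = Σ_{l<m} ε l`: monotone, `A (m+N) = A m + 2π`, `d m = d 0 · e^{i A m}`
  set A : ℕ → ℝ := fun m => ∑ l ∈ range m, ε l with hA
  have hAsucc : ∀ m, A (m + 1) = A m + ε m := fun m => sum_range_succ _ _
  have hAmono : Monotone A := monotone_nat_of_le_succ fun m => by rw [hAsucc]; linarith [(hε m).1]
  have hAper : ∀ m, A (m + N) = A m + 2 * π := fun m => by
    simp only [hA]
    rw [sum_range_add, sum_range_add_of_periodic hper m, hsum]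
  have hdA : ∀ m, d m = d 0 * exp (A m * I) := by
    intro m
    induction m with
    | zero => simp [hA]
    | succ m ih => rw [hd m, ih, hAsucc, mul_assoc, ← Complex.exp_add]; push_cast; ring_nf
  have him : ∀ m j, (d m * conj (d j)).im = normSq (d 0) * Real.sin (A m - A j) := by
    intro m j
    rw [hdA m, hdA j, map_mul, ← exp_conj, map_mul, conj_ofReal, conj_I]
    have : d 0 * exp (A m * I) * (conj (d 0) * exp (A j * -I)) =
        (d 0 * conj (d 0)) * exp ((A m - A j : ℝ) * I) := by
      rw [mul_mul_mul_comm, ← Complex.exp_add]; push_cast; ring_nf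
    rw [this, mul_conj, im_ofReal_mul, exp_ofReal_mul_I_im]
  -- forward representation of `Q i − Q j` and the sign of its terms
  have hfwd : ∀ j i, j ≤ i → Q i - Q j = ∑ m ∈ Ico j i, (lam m : ℂ) * d m := by
    intro j i hji
    induction i, hji using Nat.le_induction with
    | base => simp
    | succ i hji ih => rw [sum_Ico_succ_top hji, ← ih, hQ i]; ring
  have hterm : ∀ m j, ((lam m : ℂ) * d m * conj (d j)).im = lam m * (normSq (d 0) * Real.sin (A m - A j)) := by
    intro m j; rw [mul_assoc, im_ofReal_mul, him]
  -- the claim for `j ≤ i ≤ j + N`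
  have hmain : ∀ j i, j ≤ i → i ≤ j + N → 0 ≤ ((Q i - Q j) * conj (d j)).im := by
    intro j i hji hiN
    by_cases hall : ∀ m ∈ Ico j i, A m - A j ≤ π
    · rw [hfwd j i hji, sum_mul, im_sum]
      refine sum_nonneg fun m hm => ?_
      rw [hterm]
      have h1 : 0 ≤ A m - A j := sub_nonneg.2 (hAmono (mem_Ico.1 hm).1)
      exact mul_nonneg (hlam m)
        (mul_nonneg (normSq_nonneg _) (Real.sin_nonneg_of_nonneg_of_le_pi h1 (hall m hm)))
    · push Not at hall
      obtain ⟨m₀, hm₀, hgt⟩ := hall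
      have hi : π < A i - A j := by
        have : A m₀ ≤ A i := hAmono (mem_Ico.1 hm₀).2.le
        linarith
      have hb : Q i - Q j = -∑ m ∈ Ico i (j + N), (lam m : ℂ) * d m := by
        rw [← hfwd i (j + N) hiN, hQper]; ring
      rw [hb, neg_mul, neg_im, sum_mul, im_sum, neg_nonneg]
      refine sum_nonpos fun m hm => ?_
      rw [hterm]
      have hm1 : π ≤ A m - A j := hi.le.trans (sub_le_sub_right (hAmono (mem_Ico.1 hm).1) _)
      have hm2 : A m - A j ≤ 2 * π := by
        have : A m ≤ A (j + N) := hAmono (mem_Ico.1 hm).2.le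
        rw [hAper] at this; linarith
      have hsin : Real.sin (A m - A j) ≤ 0 := by
        rw [← Real.sin_sub_two_pi]
        exact Real.sin_nonpos_of_nonpos_of_neg_pi_le (by linarith) (by linarith)
      exact mul_nonpos_of_nonneg_of_nonpos (hlam m)
        (mul_nonpos_of_nonneg_of_nonpos (normSq_nonneg _) hsin)
  -- general `i, j` by periodicity of `Q`
  have hQk : ∀ m k, Q (m + k * N) = Q m := by
    intro m k
    induction k with
    | zero => simp
    | succ k ih => rw [Nat.succ_mul, ← add_assoc, hQper, ih]
  intro i j
  have hjM : j ≤ i + j * N := le_add_left (Nat.le_mul_of_pos_right _ hN)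
  obtain ⟨q, r, hrN, hdec⟩ : ∃ q r, r < N ∧ i + j * N = j + r + q * N := by
    refine ⟨(i + j * N - j) / N, (i + j * N - j) % N, Nat.mod_lt _ hN, ?_⟩
    have hdm := Nat.div_add_mod (i + j * N - j) N
    generalize (i + j * N - j) / N = q at hdm ⊢
    generalize (i + j * N - j) % N = r at hdm ⊢
    generalize j * N = M at hdm hjM ⊢
    have hcomm : q * N = N * q := Nat.mul_comm _ _
    generalize N * q = P at hdm hcomm
    omega
  have hQi : Q i = Q (j + r) := by rw [← hQk i j, hdec, hQk]
  rw [hQi]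
  exact hmain j (j + r) (Nat.le_add_right _ _) (by omega)

end Summit.CriticalPhenomena.CardyFormulaZ2.Cruxes.ParafermionToSLESixFamilies.PotentialDarbouxPicardDiamond

end
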